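import Mathlib
import Summits.KontsevichZagierPeriods.Zeta5Search.HarmonicWolstenholme
import HarnessLib

/-!
# ζ(5) search — the CUBIC Wolstenholme congruence `H_{p−1} + (p/2)·H⁽²⁾_{p−1} ≡ 0 (mod p³)` (tool for the fourth digit (V4))

Cell `pub-zeta5` (HONEST FRAMING: systematic search; no irrationality claim unless certified), gen-2 seat generation 14
(REPORT-gen2-g14 §1).  The fourth `p`-adic digit of the constant-term piece `V_x` (statement `SecondResidueLaw.FourthDigitV`, staged)
carries the universal constant `λ_p := H⁽²⁾_{p−1}/(2p)`; the reason is the elementary congruence proved here, one order beyond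
WOLSTENHOLME (`padicNorm_harm_pred_le_two`), for a prime `p ≥ 5`:
* `sum_univ_erase_zpow_neg_three` — in `ZMod p`: `Σ_{a ≠ 0} a⁻³ = Σ_a a^{p−4} = 0` (`0 < p − 4 < p − 1`, and `Σ_a a = 0` for `p = 5`);
* `padicNorm_harm3_pred_le` — **`H⁽³⁾_{p−1} ≡ 0 (mod p)`**;
* `padicNorm_harm_add_half_p_harm2_le_three` — **`‖H_{p−1} + (p/2)H⁽²⁾_{p−1}‖_p ≤ p⁻³`**: with `u = j+1`,
  `2H_{p−1} = p·T`, `T = Σ_j 1/(u(p−u))`, and termwise `1/(u(p−u)) + 1/u² + p/u³ = p²/(u³(p−u))`, so `T ≡ −H⁽²⁾_{p−1} − pH⁽³⁾_{p−1} (mod p²)`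
  and `H_{p−1} + (p/2)H⁽²⁾ = (p/2)(T + H⁽²⁾ + pH⁽³⁾) − (p²/2)H⁽³⁾`.
`p`-adic norms of rational numbers; nothing here concerns irrationality.
-/

noncomputable section

open Finset

namespace Summit.KontsevichZagierPeriods.Zeta5Search.SecondOrder

open Summit.KontsevichZagierPeriods.Zeta5Search.PadicSeries
open Summit.KontsevichZagierPeriods.Zeta5Search.ClusterValuation (PInt.intCast PInt.zpow_int PInt.cast_zpow_int PInt.sum PInt.cast_sum
  PInt.pCong_of_cast_eq_zero pCong padicNorm_le_of_val)
open Summit.KontsevichZagierPeriods.Zeta5Search.CellA (padicNorm_p padicNorm_inv_sub_inv_le harm_succ padicNorm_harm_le_one padicNorm_pow_eq)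
open Summit.KontsevichZagierPeriods.Zeta5Search.ResidueLaw (sum_range_erase_eq_sum_univ_erase)
open Literature.NumberTheory.Transcendental.BallRivoal (harm)

variable {p : ℕ} [hp : Fact p.Prime]

/-! ### `H^{(3)}_{p−1} ≡ 0 (mod p)` -/

/-- In `ZMod p` (`p ≥ 5`): `Σ_{a ≠ 0} a^{−3} = 0`. -/
theorem sum_univ_erase_zpow_neg_three (hp5 : 5 ≤ p) : ∑ a ∈ (univ : Finset (ZMod p)).erase 0, a ^ (-(3 : ℤ)) = 0 := by
  have hcard : Fintype.card (ZMod p) = p := ZMod.card p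
  -- `a^{-3} = a^{p-4}` for `a ≠ 0`
  have hconv : ∀ a ∈ (univ : Finset (ZMod p)).erase 0, a ^ (-(3 : ℤ)) = a ^ (p - 4) := by
    intro a ha
    have ha0 : a ≠ 0 := (mem_erase.1 ha).1
    have hF : a ^ (p - 1) = 1 := ZMod.pow_card_sub_one_eq_one ha0
    have e : a ^ (p - 4) * a ^ 3 = 1 := by rw [← pow_add, show p - 4 + 3 = p - 1 by omega, hF]
    rw [show (-(3 : ℤ)) = -((3 : ℕ) : ℤ) by norm_num, zpow_neg, zpow_natCast]
    exact (eq_inv_of_mul_eq_one_left e).symm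
  rw [sum_congr rfl hconv, sum_erase_eq_sub (mem_univ _), zero_pow (by omega), sub_zero]
  exact FiniteField.sum_pow_lt_card_sub_one (K := ZMod p) (p - 4) (by rw [hcard]; omega)

/-- **`H^{(3)}_{p−1} ≡ 0 (mod p)`** for a prime `p ≥ 5`. -/
theorem padicNorm_harm3_pred_le (hp5 : 5 ≤ p) : padicNorm p (harm 3 (p - 1)) ≤ (p : ℚ) ^ (-(1 : ℤ)) := by
  have hp1 := hp.out.one_lt
  have hterm : ∀ m : ℕ, (1 : ℚ) / ((m : ℚ) + 1) ^ 3 = (((m + 1 : ℕ) : ℤ) : ℚ) ^ (-(3 : ℤ)) := by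
    intro m
    rw [show (-(3 : ℤ)) = -((3 : ℕ) : ℤ) by norm_num, zpow_neg, zpow_natCast, one_div]
    push_cast; ring
  have hunit : ∀ m ∈ range (p - 1), ¬ (p : ℤ) ∣ ((m + 1 : ℕ) : ℤ) := by
    intro m hm h
    have hm' := mem_range.1 hm
    have := Int.le_of_dvd (by push_cast; omega) h
    push_cast at this; omega
  have hden : ∀ m ∈ range (p - 1), ¬ p ∣ ((1 : ℚ) / ((m : ℚ) + 1) ^ 3).den := by
    intro m hm; rw [hterm m]; exact PInt.zpow_int (hunit m hm) _
  have hdenS : ¬ p ∣ (harm 3 (p - 1)).den := by rw [harm]; exact PInt.sum hden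
  have hcast : ((harm 3 (p - 1) : ℚ) : ZMod p) = 0 := by
    rw [harm, PInt.cast_sum hden]
    have h1 : ∀ m ∈ range (p - 1), (((1 : ℚ) / ((m : ℚ) + 1) ^ 3 : ℚ) : ZMod p) = (((m + 1 : ℕ) : ℕ) : ZMod p) ^ (-(3 : ℤ)) := by
      intro m hm
      rw [hterm m, PInt.cast_zpow_int (hunit m hm), Int.cast_natCast]
    rw [sum_congr rfl h1]
    have h2 : ∑ m ∈ range (p - 1), (((m + 1 : ℕ) : ℕ) : ZMod p) ^ (-(3 : ℤ)) =
        ∑ y ∈ (range p).erase 0, ((y : ℕ) : ZMod p) ^ (-(3 : ℤ)) := by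
      have h3 : (range p).erase 0 = Ico 1 p := by
        ext y; simp only [Finset.mem_erase, Finset.mem_range, Finset.mem_Ico]; omega
      rw [h3, Finset.sum_Ico_eq_sum_range]
      refine sum_congr (by rw [show p - 1 = p - 1 from rfl]) fun m _ => by rw [add_comm]
    rw [h2, sum_range_erase_eq_sum_univ_erase (fun z : ZMod p => z ^ (-(3 : ℤ))) hp.out.pos, Nat.cast_zero]
    exact sum_univ_erase_zpow_neg_three hp5
  have h := PInt.pCong_of_cast_eq_zero hdenS hcast
  rw [pCong, decide_eq_true_iff] at h
  exact padicNorm_le_of_val fun hne => h.resolve_left hne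

/-! ### The cubic Wolstenholme congruence -/

/-- **`H_{p−1} + (p/2)·H^{(2)}_{p−1} ≡ 0 (mod p³)`** (`p ≥ 5`): `‖H_{p−1} + (p/2)H⁽²⁾_{p−1}‖_p ≤ p⁻³`.  Equivalently
`H_{p−1}/p² ≡ −H⁽²⁾_{p−1}/(2p) = −λ_p (mod p)` — the source of the `λ_p`-term of the fourth `V`-digit (REPORT-gen2-g14 §1). -/
theorem padicNorm_harm_add_half_p_harm2_le_three (hp5 : 5 ≤ p) :
    padicNorm p (harm 1 (p - 1) + (p : ℚ) / 2 * harm 2 (p - 1)) ≤ (p : ℚ) ^ (-(3 : ℤ)) := by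
  have h1p := hp.out.one_lt
  have hp2 : p ≠ 2 := by omega
  have hp0 : (p : ℚ) ≠ 0 := Nat.cast_ne_zero.2 hp.out.ne_zero
  have htwo : padicNorm p (2 : ℚ) = 1 := padicNorm_two hp2
  -- units
  have hu1 : ∀ j ∈ range (p - 1), padicNorm p ((j : ℚ) + 1) = 1 := by
    intro j hj
    have hj' := mem_range.1 hj
    have e : ((j : ℚ) + 1) = ((j + 1 : ℕ) : ℚ) := by push_cast; ring
    rw [e]
    have := (padicNorm.nat_eq_one_iff (p := p) (j + 1)).2 (fun h => by have := Nat.le_of_dvd (by omega) h; omega)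
    exact_mod_cast this
  have hu2 : ∀ j ∈ range (p - 1), padicNorm p ((p : ℚ) - 1 - j) = 1 := by
    intro j hj
    have hj' := mem_range.1 hj
    have e : ((p : ℚ) - 1 - j) = ((p - 1 - j : ℕ) : ℚ) := by
      rw [Nat.cast_sub (by omega), Nat.cast_sub h1p.le]; push_cast; ring
    rw [e]
    have := (padicNorm.nat_eq_one_iff (p := p) (p - 1 - j)).2 (fun h => by have := Nat.le_of_dvd (by omega) h; omega)
    exact_mod_cast this
  -- `2 H_{p-1} = p · T` with `T = Σ_j 1/((j+1)(p-1-j))`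
  set T := ∑ j ∈ range (p - 1), 1 / (((j : ℚ) + 1) * ((p : ℚ) - 1 - j)) with hT
  have hrefl : harm 1 (p - 1) = ∑ j ∈ range (p - 1), 1 / ((p : ℚ) - 1 - j) := by
    rw [harm, ← sum_range_reflect]
    refine sum_congr rfl fun j hj => ?_
    have hj' := mem_range.1 hj
    rw [pow_one, Nat.cast_sub (by omega), Nat.cast_sub (by omega), Nat.cast_sub h1p.le]
    push_cast; ring
  have hsum : 2 * harm 1 (p - 1) = (p : ℚ) * T := by
    have h2 : 2 * harm 1 (p - 1) = harm 1 (p - 1) + ∑ j ∈ range (p - 1), 1 / ((p : ℚ) - 1 - j) := by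
      rw [two_mul, ← hrefl]
    rw [h2, harm, ← sum_add_distrib, hT, mul_sum]
    refine sum_congr rfl fun j hj => ?_
    have h1 : ((j : ℚ) + 1) ≠ 0 := fun h => by have := hu1 j hj; rw [h, padicNorm.zero] at this; exact zero_ne_one this
    have h2 : ((p : ℚ) - 1 - j) ≠ 0 := fun h => by have := hu2 j hj; rw [h, padicNorm.zero] at this; exact zero_ne_one this
    rw [pow_one]; field_simp; ring
  -- `T ≡ −H^{(2)}_{p-1} − p·H^{(3)}_{p-1} (mod p²)` termwise: `1/((j+1)(p-1-j)) + 1/(j+1)² + p/(j+1)³ = p²/((j+1)³(p-1-j))`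
  have hTH : padicNorm p (T + harm 2 (p - 1) + (p : ℚ) * harm 3 (p - 1)) ≤ (p : ℚ) ^ (-(2 : ℤ)) := by
    rw [hT, harm, harm, mul_sum, ← sum_add_distrib, ← sum_add_distrib]
    refine padicNorm.sum_le' (fun j hj => ?_) (zpow_p_nonneg _)
    have h1 : ((j : ℚ) + 1) ≠ 0 := fun h => by have := hu1 j hj; rw [h, padicNorm.zero] at this; exact zero_ne_one this
    have h2 : ((p : ℚ) - 1 - j) ≠ 0 := fun h => by have := hu2 j hj; rw [h, padicNorm.zero] at this; exact zero_ne_one this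
    have e : 1 / (((j : ℚ) + 1) * ((p : ℚ) - 1 - j)) + 1 / ((j : ℚ) + 1) ^ 2 + (p : ℚ) * (1 / ((j : ℚ) + 1) ^ 3) =
        (p : ℚ) ^ 2 / (((j : ℚ) + 1) ^ 3 * ((p : ℚ) - 1 - j)) := by
      field_simp; ring
    rw [e, padicNorm.div, padicNorm.mul, padicNorm_pow_eq, padicNorm_pow_eq, hu1 j hj, hu2 j hj, one_pow, one_mul, div_one,
      padicNorm_p, ← zpow_natCast, ← zpow_mul]
    norm_num
  -- `H + (p/2)H₂ = (p/2)·(T + H₂ + pH₃) − (p²/2)·H₃`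
  have e : harm 1 (p - 1) + (p : ℚ) / 2 * harm 2 (p - 1) =
      (p : ℚ) / 2 * (T + harm 2 (p - 1) + (p : ℚ) * harm 3 (p - 1)) - (p : ℚ) ^ 2 / 2 * harm 3 (p - 1) := by
    have : harm 1 (p - 1) = (p : ℚ) * T / 2 := by rw [← hsum]; ring
    rw [this]; ring
  have hA : padicNorm p ((p : ℚ) / 2 * (T + harm 2 (p - 1) + (p : ℚ) * harm 3 (p - 1))) ≤ (p : ℚ) ^ (-(3 : ℤ)) := by
    rw [padicNorm.mul, padicNorm.div, htwo, div_one, padicNorm_p]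
    calc (p : ℚ) ^ (-(1 : ℤ)) * padicNorm p (T + harm 2 (p - 1) + (p : ℚ) * harm 3 (p - 1))
        ≤ (p : ℚ) ^ (-(1 : ℤ)) * (p : ℚ) ^ (-(2 : ℤ)) := mul_le_mul_of_nonneg_left hTH (zpow_p_nonneg _)
      _ = (p : ℚ) ^ (-(3 : ℤ)) := by rw [← zpow_add₀ hp0]; norm_num
  have hB : padicNorm p ((p : ℚ) ^ 2 / 2 * harm 3 (p - 1)) ≤ (p : ℚ) ^ (-(3 : ℤ)) := by
    rw [padicNorm.mul, padicNorm.div, htwo, div_one, padicNorm_pow_eq, padicNorm_p, ← zpow_natCast, ← zpow_mul]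
    calc (p : ℚ) ^ (-(1 : ℤ) * ((2 : ℕ) : ℤ)) * padicNorm p (harm 3 (p - 1))
        ≤ (p : ℚ) ^ (-(1 : ℤ) * ((2 : ℕ) : ℤ)) * (p : ℚ) ^ (-(1 : ℤ)) :=
          mul_le_mul_of_nonneg_left (padicNorm_harm3_pred_le hp5) (zpow_p_nonneg _)
      _ = (p : ℚ) ^ (-(3 : ℤ)) := by rw [← zpow_add₀ hp0]; norm_num
  rw [e]
  exact (padicNorm.sub (p := p)).trans (max_le hA hB)

end Summit.KontsevichZagierPeriods.Zeta5Search.SecondOrder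

end
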